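import Summits.KontsevichZagierPeriods.KontsevichZagierPeriods.Theses.Grothendieck
import Literature.NumberTheory.Transcendental.KZProduct

/-!
# Crux `GpcZeta4Eq4zeta31` (stmt-KontsevichZagierPeriods-0275) — ideator 3, round 1: first lemmas

Two idea cards (`simplex-native-double-shuffle`, `heptagon-cell-zeta-kernel`); this file states
their first checkable statements over existing declarations (no proofs claimed; no `sorry`).

Orientation: the crux's own, `Δ4 = {1 > t 0 > t 1 > t 2 > t 3 > 0}` (Kontsevich's iterated
integral; smallest variable `t 3` carries `1/(1-t)`).
-/

noncomputable section

set_option linter.dupNamespace false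

namespace Summit.KontsevichZagierPeriods.KontsevichZagierPeriods.Cruxes.GpcZeta4Eq4zeta31.Ideator3

open scoped BigOperators
open Set MeasureTheory
open Literature.NumberTheory.Transcendental
open Literature.NumberTheory.Transcendental.KZ
open Summit.KontsevichZagierPeriods.KontsevichZagierPeriods.Theses.Grothendieck (GpcZeta4Eq4zeta31)

/-! ## Card `simplex-native-double-shuffle` -/

/-- The crux's simplex. -/
def Δ4 : Set (Fin 4 → ℝ) := {t | 1 > t 0 ∧ t 0 > t 1 ∧ t 1 > t 2 ∧ t 2 > t 3 ∧ t 3 > 0}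
/-- The `ζ(2)` simplex. -/
def Δ2 : Set (Fin 2 → ℝ) := {s | 1 > s 0 ∧ s 0 > s 1 ∧ s 1 > 0}
/-- `Δ2 × Δ2 ⊆ ℝ⁴` (coordinates `(a₀,a₁,b₀,b₁) = (x 0, x 1, x 2, x 3)`). -/
def Δ2xΔ2 : Set (Fin 4 → ℝ) :=
  {x | (1 > x 0 ∧ x 0 > x 1 ∧ x 1 > 0) ∧ (1 > x 2 ∧ x 2 > x 3 ∧ x 3 > 0)}

/-- `ω₀ω₀ω₀ω₁ = ζ(4)` (the crux's first integrand). -/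
def ω4 (t : Fin 4 → ℝ) : ℝ := 1 / (t 0 * t 1 * t 2 * (1 - t 3))
/-- `ω₀ω₀ω₁ω₁ = ζ(3,1)` (a quarter of the crux's second integrand). -/
def ω31 (t : Fin 4 → ℝ) : ℝ := 1 / (t 0 * t 1 * (1 - t 2) * (1 - t 3))
/-- `ω₀ω₁ω₀ω₁ = ζ(2,2)`. -/
def ω22 (t : Fin 4 → ℝ) : ℝ := 1 / (t 0 * (1 - t 1) * t 2 * (1 - t 3))
/-- `ω₀ω₁ = ζ(2)`. -/
def ω2 (s : Fin 2 → ℝ) : ℝ := 1 / (s 0 * (1 - s 1))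
/-- `ω2 ⊗ ω2` on `Δ2 × Δ2`. -/
def ω2ω2 (x : Fin 4 → ℝ) : ℝ := 1 / (x 0 * (1 - x 1) * x 2 * (1 - x 3))
/-- THE HUB: the transport of `ω2 ⊗ ω2` along `Ξ`; a positive convergent cell-form of `M_{0,7}` on
`Δ4` (the cell `(0,t₁,t₂,1,t₃,t₄,∞)` of Brown–Carr–Schneps, normalised). -/
def η (t : Fin 4 → ℝ) : ℝ := 1 / (t 0 * (1 - t 1) * t 2 * (t 1 - t 3))

/-- The conical product map `Ξ(a₀,a₁,b₀,b₁) = (a₀, a₁, a₁b₀, a₁b₁)`: a POLYNOMIAL bijection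
`Δ2 × Δ2 → Δ4`, `|det Ξ'| = a₁²` (Markarian arXiv:2008.00855, proof of Prop. 2, eq. (e1);
Soudères arXiv:0808.0248 §1.3). -/
def Ξ (x : Fin 4 → ℝ) : Fin 4 → ℝ := ![x 0, x 1, x 1 * x 2, x 1 * x 3]
/-- The block reversal `sw₄` in simplicial coordinates, `Φ(t) = (t₃/t₂, t₃/t₁, t₃/t₀, t₃)`: a
rational INVOLUTION of `Δ4` (a reflection of the heptagon `D₇ ⊂ Aut M_{0,7}` preserving the cell),
`|det Φ'| = t₃³/(t₀t₁t₂)²`. -/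
def Φ (t : Fin 4 → ℝ) : Fin 4 → ℝ := ![t 3 / t 2, t 3 / t 1, t 3 / t 0, t 3]
/-- `|det Φ'|` on `Δ4`. -/
def JΦ (t : Fin 4 → ℝ) : ℝ := t 3 ^ 3 / (t 0 * t 1 * t 2) ^ 2

/-- FIRST LEMMA of the line (pointwise; `field_simp` + `ring` material): **the stuffle defect is a
`Φ`-coboundary** — `η = ω22 + Φ^*(ω4 + ω22)`. Verified in exact arithmetic at 64 random rational
points of `Δ4` and by hand (this session). -/
def StuffleIdentity : Prop :=
  ∀ t ∈ Δ4, η t = ω22 t + (ω4 (Φ t) + ω22 (Φ t)) * JΦ t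

/-- `Ξ` transports `ω2 ⊗ ω2` to `η`: `ω2ω2 x = η (Ξ x) · a₁²` on `Δ2 × Δ2` (pointwise). -/
def XiTransport : Prop :=
  ∀ x ∈ Δ2xΔ2, ω2ω2 x = η (Ξ x) * (x 1) ^ 2

/-- `Φ` is an involution of `Δ4` (pointwise). -/
def PhiInvolution : Prop :=
  (∀ t ∈ Δ4, Φ t ∈ Δ4) ∧ ∀ t ∈ Δ4, Φ (Φ t) = t

/-- `Ξ` is a bijection `Δ2 × Δ2 → Δ4` with inverse `t ↦ (t₀, t₁, t₂/t₁, t₃/t₁)`. -/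
def XiBijection : Prop :=
  (∀ x ∈ Δ2xΔ2, Ξ x ∈ Δ4) ∧ InjOn Ξ Δ2xΔ2 ∧ Ξ '' Δ2xΔ2 = Δ4

/-- St(2,2) INSIDE THE RULES, simplex-native (5 moves after `of_mul_of`):
`[Δ2,ω2]·[Δ2,ω2] − [Δ4,ω4] − 2[Δ4,ω22] ∈ KZ.relations`. -/
def SimplexStuffle22 : Prop :=
  ∀ (p : IntegralRep 2) (r4 r22 : IntegralRep 4),
    p.domain = Δ2 → EqOn p.integrand ω2 p.domain →
    r4.domain = Δ4 → EqOn r4.integrand ω4 r4.domain →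
    r22.domain = Δ4 → EqOn r22.integrand ω22 r22.domain →
    of p * of p - of r4 - 2 • of r22 ∈ relations

/-- Sh(2,2) INSIDE THE RULES (dissection of `Δ2 × Δ2` into the six order cells + coordinate
permutations): `[Δ2,ω2]·[Δ2,ω2] − 2[Δ4,ω22] − 4[Δ4,ω31] ∈ KZ.relations`
(= `FurushoPentagon.ShuffleIsDissection` at `s = t = [2]`). -/
def SimplexShuffle22 : Prop :=
  ∀ (p : IntegralRep 2) (r22 r31 : IntegralRep 4),
    p.domain = Δ2 → EqOn p.integrand ω2 p.domain →
    r22.domain = Δ4 → EqOn r22.integrand ω22 r22.domain →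
    r31.domain = Δ4 → EqOn r31.integrand ω31 r31.domain →
    of p * of p - 2 • of r22 - 4 • of r31 ∈ relations

/-- Representations with the pinned domains/integrands exist (routine: semialgebraic rational
data, absolute convergence of positive MZV integrands — `KZ.mzvRep [2]`, `[2,2]`, `[3,1]` up to the
`openOrderedSimplex`/`Δ` bookkeeping). -/
def RepsExist : Prop :=
  (∃ p : IntegralRep 2, p.domain = Δ2 ∧ EqOn p.integrand ω2 p.domain) ∧
  (∃ r : IntegralRep 4, r.domain = Δ4 ∧ EqOn r.integrand ω22 r.domain) ∧
  (∃ r : IntegralRep 4, r.domain = Δ4 ∧ EqOn r.integrand ω31 r.domain)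

/-- Shape of the line: `T = Sh − St`, then the `∀ r r'` glue (`4 • [Δ4, ω31] ≡ [Δ4, 4ω31]` by
integrand additivity; equal domain + `EqOn` ⇒ equivalent, refuter g8-4 / Glue4). -/
def LineShape : Prop :=
  SimplexStuffle22 → SimplexShuffle22 → RepsExist → GpcZeta4Eq4zeta31

/-! ## Card `heptagon-cell-zeta-kernel` (transfer `C⁺`) -/

/-- Value of a label of the heptagon `(0, t₀, t₁, t₂, t₃, 1, ∞)` = labels `0,1,2,3,4,5,6`
(label `6 = ∞` is never evaluated). BCS orientation of the cell: `X = {0 < t₀ < t₁ < t₂ < t₃ < 1}`. -/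
def labVal (t : Fin 4 → ℝ) (l : Fin 7) : ℝ :=
  if l.val = 0 then 0 else if l.val = 5 then 1 else if h : l.val - 1 < 4 then t ⟨l.val - 1, h⟩ else 0

/-- The standard cell in BCS orientation. -/
def Xcell : Set (Fin 4 → ℝ) := {t | 0 < t 0 ∧ t 0 < t 1 ∧ t 1 < t 2 ∧ t 2 < t 3 ∧ t 3 < 1}

/-- The cell-form of a cyclic arrangement `γ` of the seven labels (Brown–Carr–Schneps 2010,
Def. 2.x): product over cyclically consecutive pairs not containing `∞` of `1/(z_next − z_prev)`. -/
def cellForm (γ : Equiv.Perm (Fin 7)) (t : Fin 4 → ℝ) : ℝ :=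
  ∏ i : Fin 7, (if γ i = 6 ∨ γ (i + 1) = 6 then (1 : ℝ)
    else 1 / (labVal t (γ (i + 1)) - labVal t (γ i)))

/-- A cyclic block of `γ`: the image of a cyclic interval of length `L`. -/
def block (γ : Equiv.Perm (Fin 7)) (i : Fin 7) (L : ℕ) : Finset (Fin 7) :=
  (Finset.range L).image fun k : ℕ => γ (i + ⟨k % 7, Nat.mod_lt k (by norm_num)⟩)

/-- BCS convergence criterion (arXiv:0910.0122, Def. 3.4): `γ` shares no block of size `2..5` with
the standard heptagon `id`; then `cellForm γ` has constant sign and converges absolutely on `Xcell`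
(23 such polygons for `n = 7`, spanning the 22-dimensional `H⁴(M^δ_{0,7})`). -/
def IsConvergentPolygon (γ : Equiv.Perm (Fin 7)) : Prop :=
  ∀ (i j : Fin 7) (L : ℕ), 2 ≤ L → L ≤ 5 → block γ i L ≠ block (Equiv.refl (Fin 7)) j L

/-- TRANSFER `C⁺` (card `heptagon-cell-zeta-kernel`): Conjecture 1 in KERNEL FORM on the weight-4
cell-zeta sector — every vanishing `ℤ`-combination of convergent cell-zeta representations of
`M_{0,7}` over the standard cell lies in `KZ.relations`. Provable unconditionally by the machine
(product cells + `D₇` relabellings + Arnold re-expansions: `ℚ`-solution space of dimension 1,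
computed this session = BCS §4.4.2) plus `ζ(2)² ≠ 0` and `FurushoPentagon.IntegerDivision`.
It contains `cFds4` (this crux), `cEuler4`, `cHoffman4`, `cDual4` of
`Theorems/MzvKernelInKZ/Negative/WeightFour.lean` (the 01-forms are `ℤ`-combinations of
convergent cell forms). -/
def Weight4CellZetaKernel : Prop :=
  ∀ (ι : Type) [Fintype ι] (γ : ι → Equiv.Perm (Fin 7)) (a : ι → ℤ) (r : ι → IntegralRep 4),
    (∀ i, IsConvergentPolygon (γ i)) → (∀ i, (r i).domain = Xcell) →
    (∀ i, EqOn (r i).integrand (cellForm (γ i)) Xcell) →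
    eval (∑ i, a i • of (r i)) = 0 → (∑ i, a i • of (r i)) ∈ relations

/-- The two generating relabellings of `D₇` on the cell (BCS orientation): rotation
`R(t) = (1 − t₀/t₁, 1 − t₀/t₂, 1 − t₀/t₃, 1 − t₀)` (order 7) and reflection
`M(t) = (1 − t₃, 1 − t₂, 1 − t₁, 1 − t₀)`; each is ONE `changeOfVariablesRel` instance on `Xcell`
mapping convergent cell forms to ± convergent cell forms (43 of 44 pull-backs of basis forms are
single basis forms; all re-expansions integral — computed). -/
def rotR (t : Fin 4 → ℝ) : Fin 4 → ℝ := ![1 - t 0 / t 1, 1 - t 0 / t 2, 1 - t 0 / t 3, 1 - t 0]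
/-- The reflection generator. -/
def refM (t : Fin 4 → ℝ) : Fin 4 → ℝ := ![1 - t 3, 1 - t 2, 1 - t 1, 1 - t 0]

/-- Machine lemma 1 (one CoV per relabelling): pull-back along `rotR` is a move. -/
def RotationMove : Prop :=
  ∀ (r r' : IntegralRep 4), r.domain = Xcell → r'.domain = Xcell →
    (∀ t ∈ Xcell, r.integrand t =
      r'.integrand (rotR t) * |(t 0) ^ 3 / ((t 1) ^ 2 * (t 2) ^ 2 * (t 3) ^ 2)|) →
    of r - of r' ∈ relations

end Summit.KontsevichZagierPeriods.KontsevichZagierPeriods.Cruxes.GpcZeta4Eq4zeta31.Ideator3
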